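/-
Copyright (c) 2026. All rights reserved.
Released under Apache 2.0 license as described in the file LICENSE.
Authors: abc-iut cell, prover seat abc-iut-w5-d039 (wave 5, gen 7).
-/
import Literature.IUT.LogVolume.UnitLogBallFixedCriterion
import Literature.IUT.LogVolume.UnitLogDyadicPowerCriterion
import HarnessLib

/-!
# Dyadic ramification index NOT a power of `2`: a unit logarithm of norm `> 1`, hence NO ball is
# `2^k · log_2(𝒪_K^×)` — the `p = 2` counterpart of the odd deep theorem

Proof-only sequel (theorems, no definitions) of `UnitLogBallFixedCriterion.lean` (this seat: a ball
`{‖y‖ ≤ ‖ϖ‖^j}` is a `p^k · log_p(𝒪_K^×)` iff `∃ N, f·N = f + m ∧ log_p(𝒪_K^×) ⊆ 𝔪^N ∧ e ∣ j − N`) and of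
abc-iut-w5-d017's squaring toolkit `UnitLogDyadicPowerCriterion.lean` (`‖1 − y^{2^n}‖ = ‖ϖ‖^{2^n s}` while
`2^n s < 2e`; the isometry range `a ≥ e + 1`; `‖L(y^{2^n})‖ = ‖ϖ‖^{ne}·‖L(y)‖`); the `p = 2` counterpart of
abc-iut-w6-d060's `UnitLogDeepRamification.lean` (odd `p`, `e ≥ p`: no ball is a `p^k · log_p(𝒪^×)`).

* `forall_closedBall_ne_zpow_smul_logUnits_of_exists_one_le_norm` (any `p`): ONE unit logarithm of norm `≥ 1`
  rules out EVERY ball (the forced exponent `N = 1 + m/f` is `≥ 1`, and `log ⊆ 𝔪^N ⊆ 𝔪` would be needed);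
* `norm_logSeries_one_sub_unif_eq` (`p = 2`): if `e + 1 ≤ 2^n < 2e` then **`‖log_2(1 − ϖ)‖ = ‖ϖ‖^{2^n − n·e}`**
  (square `n` times: the level doubles to `2^n ≥ e + 1`, inside the isometry range, then divide by `2^n`);
* `exists_mem_logUnits_one_lt_norm_of_forall_ne_pow`: if `e = e(K/ℚ_2)` is NOT a power of `2` (so `e ≥ 3` and
  `2^{n−1} < e < 2^n < 2e` for `n = ⌊log_2 e⌋ + 1 ≥ 2`), the exponent `2^n − n·e < 2e − 2e = 0` is NEGATIVE:
  `log_2(𝒪_K^×)` contains an element of norm `> 1`;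
* **`forall_closedBall_ne_zpow_smul_logUnits_two_of_forall_ne_pow`**: hence for `p = 2` and `e` not a power of
  `2`, NO ball `{‖y‖ ≤ ‖ϖ‖^j}` is a `2^k · log_2(𝒪_K^×)` — by abc-iut-w5-d180's criterion, at such a place EVERY
  ball is moved by Dupuy–Hilado's (Ind2) (consumer `Summits/ABC/IUTFork/Thm311RealIsmDHMoverDyadicNonPow.lean`).

What remains over `2` (all radii): `e ∈ {1, 2, 4, 8, …}` — `e = 1, 2` are settled in the tree (abc-iut-w5-d180 /
w5-d014 / w4-d017: `ℚ_2`, `f ≥ 2`, the quadratic cells); `e = 2^a`, `a ≥ 2` is field-dependent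
(abc-iut-w5-d017's `UnitLogDyadicFourthPowers`).  Classical local analysis (Neukirch, *Algebraic Number Theory*,
Ch. II (5.5), (5.7)); nothing here bears on the disputed [IUTchIII] Cor. 3.12.
[cite: NeukirchANT1999, Ch. II (5.5), (5.7)] [cite: WeilBNT1967, Ch. II §2, Th. 1–2]
-/

noncomputable section

open MeasureTheory Set Metric
open scoped Pointwise
open Literature.NumberTheory.GaloisRepresentations.Ultrametric

namespace Literature.IUT.LogVolume

/-! ## 1. Any `p`: one unit logarithm of norm `≥ 1` kills every ball -/

section AnyPrime

variable (p : ℕ) [Fact p.Prime]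
variable (K : Type*) [NontriviallyNormedField K] [instK : NormedAlgebra ℚ_[p] K] [IsUltrametricDist K]
  [ProperSpace K]

/-- **ONE unit logarithm of norm `≥ 1` ⇒ NO ball `{‖y‖ ≤ ‖ϖ‖^j}` is a `p^k · log_p(𝒪_K^×)`**: the structural
criterion would force `log_p(𝒪_K^×) ⊆ 𝔪^N` with `f·N = f + m`, so `N ≥ 1` and `𝔪^N ⊆ 𝔪 = {‖y‖ < 1}`.
[cite: NeukirchANT1999, Ch. II (5.5), (5.7)] -/
theorem forall_closedBall_ne_zpow_smul_logUnits_of_exists_one_le_norm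
    (hz : ∃ z ∈ logUnits K, 1 ≤ ‖z‖) {ϖ : Kˣ} (hϖ : IsUniformizer ϖ) (j k : ℤ) :
    closedBall (0 : K) (‖(ϖ : K)‖ ^ j) ≠ ((p : ℚ_[p]) ^ k) • logUnits K := by
  intro h
  obtain ⟨N, hN, hsub, -⟩ := (exists_closedBall_zpow_eq_zpow_smul_logUnits_iff p K hϖ j).1 ⟨k, h⟩
  obtain ⟨z, hz, h1⟩ := hz
  have hf : (1 : ℤ) ≤ residueDegree p K := by exact_mod_cast residueDegree_pos p K
  have hm : (0 : ℤ) ≤ torsionPExp p K := by exact_mod_cast Nat.zero_le _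
  -- `N ≥ 1`
  have hN1 : 1 ≤ N := by
    by_contra hlt
    push Not at hlt
    have : (residueDegree p K : ℤ) * N ≤ 0 := mul_nonpos_of_nonneg_of_nonpos (by linarith) (by linarith)
    linarith
  have hle : ‖z‖ ≤ ‖(ϖ : K)‖ ^ N := mem_closedBall_zero_iff.1 (hsub hz)
  have hlt1 : ‖(ϖ : K)‖ ^ N < 1 := zpow_lt_one₀ (norm_units_pos ϖ) hϖ.1 (by omega)
  linarith

end AnyPrime

/-! ## 2. `p = 2`, `e` not a power of `2`: `‖log_2(1 − ϖ)‖ = ‖ϖ‖^{2^n − ne} > 1` -/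

section Dyadic

variable (K : Type*) [NontriviallyNormedField K] [instK : NormedAlgebra ℚ_[2] K] [IsUltrametricDist K]
  [ProperSpace K]

/-- **`‖log_2(1 − ϖ)‖ = ‖ϖ‖^{2^n − n·e}` whenever `e + 1 ≤ 2^n < 2e`** (`p = 2`): squaring `n` times takes the
level `1` to `2^n` (abc-iut-w5-d017's doubling lemma, valid while `2^n < 2e`), which lies in the isometry range
`≥ e + 1`, and `L(y^{2^n}) = 2^n·L(y)`. [cite: NeukirchANT1999, Ch. II (5.5)] -/
theorem norm_logSeries_one_sub_unif_eq {ϖ : Kˣ} (hϖ : IsUniformizer ϖ) {n : ℕ}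
    (h1 : (absRamificationIdx 2 K : ℤ) + 1 ≤ 2 ^ n) (h2 : (2 : ℤ) ^ n < 2 * (absRamificationIdx 2 K : ℤ)) :
    ‖logSeries (1 - (ϖ : K))‖ = ‖(ϖ : K)‖ ^ ((2 : ℤ) ^ n - n * absRamificationIdx 2 K) := by
  have hρ0 : 0 < ‖(ϖ : K)‖ := norm_units_pos ϖ
  set y : K := 1 - (ϖ : K) with hydef
  have hy : ‖1 - y‖ = ‖(ϖ : K)‖ ^ (1 : ℤ) := by rw [hydef, sub_sub_cancel, zpow_one]
  have hyP : IsPrincipal y := by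
    show ‖1 - y‖ < 1
    rw [hy, zpow_one]
    exact hϖ.1
  -- the level after `n` squarings
  have hlevel : ‖1 - y ^ (2 ^ n)‖ = ‖(ϖ : K)‖ ^ ((2 : ℤ) ^ n * 1) :=
    RamificationCriterion.norm_one_sub_pow_two_pow hϖ hy (by rw [mul_one]; exact h2)
  rw [mul_one] at hlevel
  -- in the isometry range
  have hdeep : ‖logSeries (y ^ (2 ^ n))‖ = ‖(ϖ : K)‖ ^ ((2 : ℤ) ^ n) :=
    RamificationCriterion.norm_logSeries_of_deep hϖ hlevel h1
  -- divide by `2^n`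
  have hscale := RamificationCriterion.norm_logSeries_pow_two_pow hϖ hyP n
  rw [hdeep] at hscale
  have hne : ‖(ϖ : K)‖ ^ ((n : ℤ) * absRamificationIdx 2 K) ≠ 0 := zpow_ne_zero _ hρ0.ne'
  rw [zpow_sub₀ hρ0.ne', eq_div_iff hne, mul_comm]
  exact hscale.symm

/-- **`e(K/ℚ_2)` not a power of `2` ⇒ some unit logarithm has norm `> 1`** (`y = 1 − ϖ`, `n = ⌊log_2 e⌋ + 1`:
`2^{n−1} < e < 2^n < 2e`, `n ≥ 2`, so the exponent `2^n − ne` is negative). [cite: NeukirchANT1999, Ch. II (5.5)] -/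
theorem exists_mem_logUnits_one_lt_norm_of_forall_ne_pow (he : ∀ a : ℕ, absRamificationIdx 2 K ≠ 2 ^ a) :
    ∃ z ∈ logUnits K, 1 < ‖z‖ := by
  obtain ⟨ϖ, hϖ⟩ := exists_isUniformizer (F := K)
  have hρ0 : 0 < ‖(ϖ : K)‖ := norm_units_pos ϖ
  set e := absRamificationIdx 2 K with he_def
  have he1 : 1 ≤ e := absRamificationIdx_pos 2 K
  -- `n := Nat.log 2 e + 1`: `2^(n-1) ≤ e < 2^n`, and `2^(n-1) ≠ e`
  set n := Nat.log 2 e + 1 with hn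
  have hlt : e < 2 ^ n := Nat.lt_pow_succ_log_self (by norm_num) e
  have hle : 2 ^ (n - 1) ≤ e := by
    rw [hn, Nat.add_sub_cancel]
    exact Nat.pow_log_le_self 2 (by omega)
  have hne : 2 ^ (n - 1) ≠ e := fun h => he (n - 1) h.symm
  have hlt' : 2 ^ (n - 1) < e := lt_of_le_of_ne hle hne
  have h2e : 2 ^ n < 2 * e := by
    have : 2 ^ n = 2 * 2 ^ (n - 1) := by
      rw [hn, Nat.add_sub_cancel, pow_succ, mul_comm]
    omega
  have hn2 : 2 ≤ n := by
    by_contra hlt2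
    push Not at hlt2
    interval_cases n
    · simp at hlt; omega
    · simp at hlt
      -- `e < 2` and `e ≥ 1` ⇒ `e = 1 = 2^0`
      exact he 0 (by omega)
  have h1 : (e : ℤ) + 1 ≤ 2 ^ n := by exact_mod_cast hlt
  have h2 : (2 : ℤ) ^ n < 2 * (e : ℤ) := by exact_mod_cast h2e
  have hnorm := norm_logSeries_one_sub_unif_eq K hϖ h1 h2
  -- the unit `1 − ϖ` and its logarithm
  have hyP : IsPrincipal (1 - (ϖ : K)) := by
    show ‖1 - (1 - (ϖ : K))‖ < 1
    rw [sub_sub_cancel]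
    exact hϖ.1
  refine ⟨unitLog (1 - (ϖ : K)), unitLog_mem_logUnits hyP.norm_eq_one, ?_⟩
  rw [unitLog_of_isPrincipal 2 hyP, hnorm]
  -- negative exponent: `2^n < 2e ≤ ne`
  have hexp : (2 : ℤ) ^ n - n * (e : ℤ) < 0 := by
    have : 2 * (e : ℤ) ≤ (n : ℤ) * e := by
      have hn2' : (2 : ℤ) ≤ n := by exact_mod_cast hn2
      nlinarith
    linarith
  exact one_lt_zpow_of_neg₀ hρ0 hϖ.1 hexp

/-- **`p = 2`, `e(K/ℚ_2)` NOT a power of `2` ⇒ NO ball `{‖y‖ ≤ ‖ϖ‖^j}` is a `2^k · log_2(𝒪_K^×)`** (all radii `j`,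
all `k`; no hypothesis on `f` or on roots of unity). [cite: NeukirchANT1999, Ch. II (5.5), (5.7)]
[cite: WeilBNT1967, Ch. II §2, Th. 1–2] -/
theorem forall_closedBall_ne_zpow_smul_logUnits_two_of_forall_ne_pow (he : ∀ a : ℕ, absRamificationIdx 2 K ≠ 2 ^ a)
    {ϖ : Kˣ} (hϖ : IsUniformizer ϖ) (j k : ℤ) :
    closedBall (0 : K) (‖(ϖ : K)‖ ^ j) ≠ ((2 : ℚ_[2]) ^ k) • logUnits K := by
  obtain ⟨z, hz, hlt⟩ := exists_mem_logUnits_one_lt_norm_of_forall_ne_pow K he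
  have h := forall_closedBall_ne_zpow_smul_logUnits_of_exists_one_le_norm 2 K ⟨z, hz, hlt.le⟩ hϖ j k
  exact_mod_cast h

/-- The same for a ball `t·𝒪_K` given by any `t ≠ 0`. [cite: NeukirchANT1999, Ch. II (5.5), (5.7)] -/
theorem forall_closedBall_norm_ne_zpow_smul_logUnits_two_of_forall_ne_pow
    (he : ∀ a : ℕ, absRamificationIdx 2 K ≠ 2 ^ a) {t : K} (ht : t ≠ 0) (k : ℤ) :
    closedBall (0 : K) ‖t‖ ≠ ((2 : ℚ_[2]) ^ k) • logUnits K := by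
  obtain ⟨ϖ, hϖ⟩ := exists_isUniformizer (F := K)
  obtain ⟨j, hj⟩ := hϖ.2 (Units.mk0 t ht)
  rw [Units.val_mk0] at hj
  rw [hj]
  exact forall_closedBall_ne_zpow_smul_logUnits_two_of_forall_ne_pow K he hϖ j k

end Dyadic

end Literature.IUT.LogVolume

end
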